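import Literature.Topology.FourManifolds.HandleSlabAttachment
import Literature.Topology.FourManifolds.HandleSlabEnds
import Literature.Topology.FourManifolds.HandleSlabSingle
import Literature.Topology.FourManifolds.HandleAttachingMapsTransport
import Literature.Topology.FourManifolds.OneZeroOneHandlebodyBoundary
import HarnessLib

/-!
# A `(1,0,1)`-handlebody is the `4`-disc with one `2`-handle attached (Kosinski VII 2.2)

Topic `Literature/Topology/FourManifolds`; the first assembly of the formalisation of Kosinski,
*Differential Manifolds* (1993), VII Prop. 2.2 (`HandleSlabProfiles.lean`, `HandleSlabLevel.lean`,
`HandleSlabSet.lean`, `HandleSlabHandlePiece.lean`, `HandleSlabBaseMap.lean`,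
`HandleSlabBasePiece.lean`, `HandleSlabAttachment.lean`, `HandleSlabEnds.lean`,
`HandleSlabSingle.lean`), in the tree's model `HandleAttachingMap.IsMultiAttachment` of handle
attachment (Kosinski VI §6), serving the trace bridge T of the SPC4 crux
(`exists_framedKnot_of_hasHandleDecomposition_oneZeroOne`, `PropertyRTraceBridgeOfPropertyR.lean`:
the dictionary between Milnor's Morse-theoretic handlebodies `HasHandleDecomposition` and
Kosinski's attaching maps / Kirby's traces `FramedLink.IsTrace`).

* `SlabData.exists_isMultiAttachment_transport_closedBall` — **Kosinski VII (2.2) between a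
  `0`-handle and the boundary**: for slab data `D` on the compact `W` such that the only critical
  points of `f` at or above the level `c - ε` are the `p i`, and `f` has exactly one critical
  point in the body `{f ≤ c - ε}`, of index `0`, the manifold `W` **is** the disc `Dᵐ` with one
  `λ`-handle attached for each `p i`, along the attaching maps `h̄ᵢ = φᵢ⁻¹ ∘ H` of Part 4
  transported to `Dᵐ` by a diffeomorphism `{f ≤ c - ε} ≅ Dᵐ` (Part 5 `isMultiAttachment_slabSet`,
  top `isMultiAttachment_of_slabSet`, bottom `nonempty_diffeomorph_bodySet_closedBall`,
  transport `IsMultiAttachment.transport`).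
* `exists_isMultiAttachment_closedBall_of_hasHandleDecomposition_oneZeroOne` — **a compact
  `4`-manifold with a handle decomposition with one `0`-handle and one `2`-handle is `D⁴` with one
  `2`-handle attached** along some attaching map `h̄ : T → D⁴` (Kosinski VII (2.2) with VI (6.4);
  Kirby 1989, Ch. I §1–2: such a manifold is a knot trace `D⁴ ∪_K h²`): the two critical points
  `p` (index `0`, the minimum) and `q` (index `2`) of an adapted Morse function
  (`IsMorseAdapted.exists_criticalSet_eq_pair_of_oneZeroOne`), slab data at `q` with scale
  `ε < f q - f p` (`IsMorseAdapted.exists_morseChartAt_scale`, `SlabData.single`), and the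
  previous theorem.

Everything here is proved; no named facts are introduced.

## References

* A. A. Kosinski, *Differential Manifolds*, Academic Press (1993), VII §2, Prop. 2.2 (PDF
  pp. 100–101); VI §6, (6.4). [Kosinski1993]
* J. Milnor, *Morse theory* (1963), Thms. 3.1–3.2. [Milnor1963]
* R. C. Kirby, *The Topology of 4-Manifolds*, LNM 1374 (1989), Ch. I §1–2. [Kirby1989]
-/

open scoped Manifold ContDiff Topology
open Set Function Metric Real Filter

noncomputable section

universe u

namespace Literature.Topology.FourManifolds

open HandleShrink HandleSlab

/-! ### §1 Kosinski VII (2.2) over a `0`-handle: `W` is the disc with handles attached -/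

namespace SlabData

variable {n : ℕ} {W : Type u} [TopologicalSpace W] [ChartedSpace (EuclideanHalfSpace (n + 1)) W]
  {ι : Type*} [Fintype ι] (D : SlabData n W ι) [IsManifold (𝓡∂ (n + 1)) ∞ W] [T2Space W]
  [CompactSpace W]

/-- **Kosinski VII (2.2) between a `0`-handle and the boundary.**  Let `D` be slab data on the
compact manifold with boundary `W` (dimension `n + 1 ≥ 2`) such that the only critical points of
`f` with `f ≥ c - ε` are the `p i`, and `f` has exactly one critical point `p₀` with
`f ≤ c - ε`, of index `0`.  Then there is a diffeomorphism `e : {f ≤ c - ε} ≅ Dⁿ⁺¹` such that `W`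
is `Dⁿ⁺¹` with one `λ`-handle attached for each `i`, along the transported attaching maps
`e ∘ h̄ᵢ`. [cite: Kosinski1993, VII (2.2)] -/
theorem exists_isMultiAttachment_transport_closedBall (hn : 1 ≤ n)
    (htop : ∀ z, IsMCriticalPt (𝓡∂ (n + 1)) D.f z → D.c - D.ε ≤ D.f z → ∃ i, z = D.p i)
    {p₀ : W} (hp₀ : IsMCriticalPt (𝓡∂ (n + 1)) D.f p₀) (hp₀c : D.f p₀ ≤ D.c - D.ε)
    (h0 : morseIndex (𝓡∂ (n + 1)) D.f p₀ = 0)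
    (huniq : ∀ z, IsMCriticalPt (𝓡∂ (n + 1)) D.f z → D.f z ≤ D.c - D.ε → z = p₀) :
    ∃ e : ↥D.bodySet ≃ₘ⟮𝓡∂ (n + 1), 𝓡∂ (n + 1)⟯
        (Metric.closedBall (0 : EuclideanSpace ℝ (Fin (n + 1))) 1),
      HandleAttachingMap.IsMultiAttachment (fun i => (D.attachingMap hn i).transport e)
        (𝓡∂ (n + 1)) W := by
  have hslab := D.isMultiAttachment_slabSet hn
  have hW := D.isMultiAttachment_of_slabSet hn htop hslab
  obtain ⟨e⟩ := D.nonempty_diffeomorph_bodySet_closedBall hn hp₀ hp₀c h0 huniq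
  exact ⟨e, hW.transport e⟩

end SlabData

/-! ### §2 A `(1,0,1)`-handlebody is `D⁴` with one `2`-handle attached -/

/-- **A compact `4`-manifold with a handle decomposition with one `0`-handle, one `2`-handle and
nothing else is the `4`-disc with one `2`-handle attached** along some attaching map
`h̄ : T → D⁴`, in the sense of `HandleAttachingMap.IsMultiAttachment` (one handle, indexed by
`Fin 1`).  Kosinski VII (2.2) at the critical point `q` of index `2`, over the `0`-handle: the
minimum `p` is the only other critical point and `f p < f q - ε`. [cite: Kosinski1993, VII (2.2)] -/
theorem exists_isMultiAttachment_closedBall_of_hasHandleDecomposition_oneZeroOne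
    (P : Type u) [TopologicalSpace P] [T2Space P]
    [ChartedSpace (EuclideanHalfSpace 4) P] [IsManifold (𝓡∂ 4) ∞ P] [CompactSpace P]
    (hP : HasHandleDecomposition 3 P (fun k => if k = 0 then 1 else if k = 2 then 1 else 0)) :
    ∃ h : HandleAttachingMap 3 2 (Metric.closedBall (0 : EuclideanSpace ℝ (Fin 4)) 1),
      HandleAttachingMap.IsMultiAttachment (fun _ : Fin 1 => h) (𝓡∂ 4) P := by
  obtain ⟨f, hf, hcount⟩ := hP
  obtain ⟨p, q, hp0, hq2, hcrit, hpq⟩ := hf.exists_criticalSet_eq_pair_of_oneZeroOne hcount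
  have hpmem : p ∈ criticalSetOfIndex (𝓡∂ (3 + 1)) f 0 := by rw [hp0]; exact mem_singleton p
  have hqmem : q ∈ criticalSetOfIndex (𝓡∂ (3 + 1)) f 2 := by rw [hq2]; exact mem_singleton q
  obtain ⟨-, hlt⟩ := hf.apply_le_and_apply_lt_of_criticalSetOfIndex_zero hp0
  have hpq' : f p < f q := hlt q hqmem.1 hpq.symm
  have hqint := hf.isInteriorPoint_of_isMCriticalPt hqmem.1
  -- a Morse chart of index `2` at `q` and a scale `ε < f q - f p`
  have key := hf.exists_morseChartAt_scale hqmem.1 hqint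
  rw [hqmem.2] at key
  obtain ⟨C, hC⟩ := key
  obtain ⟨ε, hε, hεδ, hball, hlt1, hreg⟩ := hC (f q - f p) (sub_pos.2 hpq')
  set D : SlabData 3 P (Fin 1) := SlabData.single hf hqmem.1 C (by norm_num) hε hball hlt1 hreg
    with hD
  -- the hypotheses of §1 for `D`
  have hmem : ∀ z, IsMCriticalPt (𝓡∂ (3 + 1)) f z → z = p ∨ z = q := fun z hz => by
    have : z ∈ criticalSet (𝓡∂ (3 + 1)) f := hz
    rw [hcrit] at this
    simpa using this
  have htop : ∀ z, IsMCriticalPt (𝓡∂ (3 + 1)) D.f z → D.c - D.ε ≤ D.f z → ∃ i, z = D.p i := by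
    intro z hz hle
    rcases hmem z hz with rfl | rfl
    · change f q - ε ≤ f z at hle
      linarith
    · exact ⟨0, rfl⟩
  have hp₀c : D.f p ≤ D.c - D.ε := by
    change f p ≤ f q - ε; linarith
  have huniq : ∀ z, IsMCriticalPt (𝓡∂ (3 + 1)) D.f z → D.f z ≤ D.c - D.ε → z = p := by
    intro z hz hle
    rcases hmem z hz with rfl | rfl
    · rfl
    · change f z ≤ f z - ε at hle
      linarith
  have hn : (1 : ℕ) ≤ 3 := by norm_num
  obtain ⟨e, he⟩ := D.exists_isMultiAttachment_transport_closedBall hn htop hpmem.1 hp₀c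
    hpmem.2 huniq
  set g : Fin 1 → HandleAttachingMap 3 2 (Metric.closedBall (0 : EuclideanSpace ℝ (Fin 4)) 1) :=
    fun i => (D.attachingMap hn i).transport e with hgdef
  have hg : g = fun _ => g 0 := funext fun i => by rw [Fin.fin_one_eq_zero i]
  rw [hg] at he
  exact ⟨g 0, he⟩

end Literature.Topology.FourManifolds
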